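import Literature.AlgebraicGeometry.ComplexMultiplication.CMAbelianFourfoldFivefoldPowersHodge
import Literature.AlgebraicGeometry.HodgeTheory.AbelianLowDimensionNonSimpleFourfoldsFivefoldRows
import Literature.AlgebraicGeometry.HodgeTheory.RankOneCentreTimesSimpleCMSurfaceProductSpan
import Literature.AlgebraicGeometry.HodgeTheory.CodimTwoDivisorPullbackGenerated
import HarnessLib

/-!
# Moonen–Zarhin 1999 Thm. 0.2 (4) for NON-SIMPLE fivefolds — every row a theorem (`E × E' × T`, `E × Z` with `Z` a
# non-simple fourfold, the rows (5.10) `S × T` and (5.11) `E₁ × E₂ × T`), and Thm. 0.2 in CODIMENSION TWO for every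
# non-simple complex abelian fivefold outside case (e) and the residual of case (g): `B²(X) ⊆ D²(X) + Σ_α α^* B²(X')`

(Part 1) `E × (E' × T)` and `E × Z` (`Z` a non-simple fourfold), the product not of CM type and outside (e)/(f), are stably
nondegenerate GIVEN the rows (5.10)–(5.11); the master statements for non-simple fivefolds not of CM type / with no simple
fourfold factor, rows displayed as hypotheses. (Part 2) The row (5.11) `E₁ × (E₂ × T)` GLOBALLY (`rowEET`: non-isogenous CM
curves and a simple Type-IV non-CM threefold admitting neither `End⁰(E_i)`, by the tree's
`NoTypeIVTimesCMStablyNondegenerate`), so only the row (5.10) remains as a hypothesis. (Part 3) The row (5.10) `S × T`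
(a simple CM surface times a simple Type-IV non-CM threefold) BY NAME from the tree, whence **every non-simple complex
abelian fivefold without simple isogeny factor of dimension `4` and outside (e)/(f) is stably nondegenerate**
(`isStablyNondegenerate_of_dim_eq_five_of_not_isSimple`). (Part 4) A fivefold with a SIMPLE FOURFOLD isogeny factor `F`
(`X ∼ F × C`) satisfies the codimension-two pull-back statement outside the residual of case (g), and **Thm. 0.2 in
codimension `2` holds for every non-simple fivefold outside case (e) and that residual**
(`isCodimTwoDivisorPullbackGenerated_of_dim_eq_five_of_not_isSimple`; `IsCodimTwoDivisorPullbackGenerated` is the tree's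
Literature notion `B²(X) ⊆ D²(X) + Σ_α α^* B²(X')`, `α : X ↠ X'` onto abelian fourfolds).

* Part 1 — from `Ring2/NonSimpleFivefoldsHodge` (4/15 declarations; namespace
  `Literature.AlgebraicGeometry.HodgeTheory.AbelianLowDimension.NonSimpleFivefolds`): Non-simple complex abelian
  FIVEFOLDS, part 2: Moonen–Zarhin 1999 Thm. 0.2 (4) («no simple factor of dimension 4, outside (e), (f), (g) ⟹
  `B•(Xⁿ) = D•(Xⁿ)`») — the union of the tree's rows with the CorCM classification, the two all-Type-IV non-CM rows of
  …. Declarations: `isStablyNondegenerate_curve_prod_curve_prod_threefold_of_not_isOfCMType_of`,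
  `isStablyNondegenerate_curve_prod_fourfold_of_not_isSimple_of_not_isOfCMType_of`,
  `isStablyNondegenerate_of_dim_eq_five_of_not_isSimple_of_not_isOfCMType_of`,
  `isStablyNondegenerate_of_dim_eq_five_of_not_isSimple_of`.
* Part 2 — from `Ring2/NonSimpleFivefoldsRowEET` (3/10 declarations; namespace
  `Literature.AlgebraicGeometry.HodgeTheory.AbelianLowDimension.NonSimpleFivefolds`): Non-simple complex abelian
  FIVEFOLDS, part 4: the row (5.11) `E_k × E_{k'} × T` DISCHARGED — Moonen–Zarhin 1999 Thm. 0.2 (4) for non-simple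
  fivefolds modulo the single row (5.10). Declarations: `rowEET`,
  `isStablyNondegenerate_of_dim_eq_five_of_not_isSimple_of_rowST`,
  `isStablyNondegenerate_of_dim_eq_five_of_not_isSimple_of_rowST'`.
* Part 3 — from `Ring2/NonSimpleFivefoldsComplete` (2/7 declarations; namespace
  `Literature.AlgebraicGeometry.HodgeTheory.AbelianLowDimension.NonSimpleFivefolds`): Moonen–Zarhin 1999 Thm. 0.2 (4)
  for non-simple complex abelian fivefolds — COMPLETE: every complex abelian variety of dimension `≤ 5`, not a simple
  fivefold, without simple fourfold isogeny factor, outside the printed cases (a)/(e)/(f), satisfies `B•(Xⁿ) = ….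
  Declarations: `rowST`, `isStablyNondegenerate_of_dim_eq_five_of_not_isSimple`.
* Part 4 — from `Ring2/NonSimpleFivefoldsCodimTwo` (2/6 declarations; namespace
  `Literature.AlgebraicGeometry.HodgeTheory.AbelianLowDimension.NonSimpleFivefoldsCodimTwo`): MOONEN–ZARHIN Thm. 0.2
  IN CODIMENSION 2 — `B²(X) ⊆ D²(X) + Σ_α α^* B²(X')` — FOR EVERY NON-SIMPLE COMPLEX ABELIAN FIVEFOLD OUTSIDE CASE (e)
  AND THE RESIDUAL OF CASE (g), UNCONDITIONALLY; the named fact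
  `MoonenZarhin1999_codimTwoHodgeClasses_abelianFivefold` …. Declarations:
  `isCodimTwoDivisorPullbackGenerated_of_avDominatedBy_simpleFourfold`,
  `isCodimTwoDivisorPullbackGenerated_of_dim_eq_five_of_not_isSimple`.

## References

* [MoonenZarhin1999LowDim] B. Moonen, Yu. Zarhin, Math. Ann. 315 (1999) 711–733: Thm. 0.2 (4), Thm. (3.2), Lemmas
  (3.4), (3.6), Prop. (3.8), §5 (5.6)–(5.11) [corpus: paper:arxiv-math_9901113]. [cite: MoonenZarhin1999LowDim, Thm.
  0.2 (4) and §5 (5.6)–(5.11)]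
* [MumfordAV1970] D. Mumford, *Abelian Varieties* (1970), §19 Thm. 1 and Cor. 1–2 (pp. 173–174). [cite: MumfordAV1970,
  §19 Thm. 1 (pp. 173–174)]
* [vanGeemen1994HodgeAV] B. van Geemen, LNM 1594 (1994), §3.6, Lemma 3.7. [cite: vanGeemen1994HodgeAV, Lemma 3.7 and
  §3.6]
* [Milne1999] J. S. Milne, Compositio Math. 117 (1999), §2 p. 54. [cite: Milne1999, §2 p. 54]
* [RamonMari2008] J. J. Ramón Marí, Collect. Math. 59 (2008), Prop. 2.18 [corpus: paper:arxiv-math_0505357 p0006].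
  [cite: RamonMari2008, Prop. 2.18]
* [Deligne2000] P. Deligne, *The Hodge conjecture* (Clay, 2000), §1. [cite: Deligne2000, §1]
* [Pohlmann1968] H. Pohlmann, Ann. of Math. 88 (1968), Thm. 1 (simple CM abelian varieties of prime dimension).
* [Ribet1983] K. A. Ribet, Amer. J. Math. 105 (1983) (with Tankeev: simple abelian varieties of prime dimension).

Provenance: Literature home of the used declarations of the Summits-side modules listed part by part above (cells
`pub-hodge-ring2` / `pub-hodgecm2`; namespaces `Summit.HodgeConjecture.Ring2.NonSimpleFivefolds`,
`Summit.HodgeConjecture.Ring2.NonSimpleFivefoldsCodimTwo` re-rooted under `Literature.AlgebraicGeometry.…` as stated),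
whose imports are `Literature/` and Mathlib only for the declarations used; re-homed verbatim (proofs unchanged) so
that Literature users are served without importing `Summits/`. Lane `lit-hodgefound`, seat p20 (generation 34).
Theorems only: no definition, no named fact, no `sorry`; axioms `propext`, `Classical.choice`, `Quot.sound`.
-/

/-! ## Part 1: NonSimpleFivefoldsHodge -/

noncomputable section

open _root_.CategoryTheory _root_.CategoryTheory.Limits

namespace Literature.AlgebraicGeometry.HodgeTheory.AbelianLowDimension.NonSimpleFivefolds

open Literature.AlgebraicGeometry.Motives (AbelianVariety)
open Literature.AlgebraicGeometry.Motives.AbelianVariety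
open Literature.AlgebraicGeometry.HodgeTheory
open Literature.AlgebraicGeometry.Milne1999
open Literature.AlgebraicGeometry.ComplexMultiplication
open Literature.AlgebraicGeometry.ComplexMultiplication.Domination
open Literature.AlgebraicGeometry.HodgeTheory.AbelianLowDimension.NonSimpleFourfolds

variable {X Y Z E E' E₁ E₂ E₃ E₄ E₅ T S S₁ S₂ : AbelianVariety ℂ}

/-! ### §2 (continued) The rows with a simple threefold factor -/

/-- **`E × (E' × T)` for two elliptic curves and a threefold `T`, the product NOT of CM type and outside (e)/(f), is
stably nondegenerate — GIVEN the row (5.11) `E₁ × E₂ × T`** (displayed as `hEET`, relative to `E × (E' × T)`: two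
non-isogenous CM curves, `T` simple of Type IV not of CM type admitting neither field). `T` non-simple: `T ∼ E'' × S` and
the four-piece theorem; `T` simple: `E ∼ E'` ⟹ `X ∼ E² × T`, mixed powers of the complete row `E × T` (Prop. (3.8));
`Hom(E', E) = 0` and `E` non-CM ⟹ the `A × E` row over `E' × T`; `E` CM, `E'` non-CM ⟹ the same with the roles
exchanged; both CM ⟹ `T` without factor of Type IV: Thm. (3.2)(2) with `C = E × E'`; `T` CM: the product would be CM;
else `hEET`. [cite: MoonenZarhin1999LowDim, §5 (5.6)–(5.9), (5.11), Thm. (3.2)(2), Lemma (3.4), Prop. (3.8)]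
[cite: Milne1999, §2 p. 54] -/
theorem isStablyNondegenerate_curve_prod_curve_prod_threefold_of_not_isOfCMType_of (hE : E.dim = 1) (hE' : E'.dim = 1)
    (hT3 : T.dim = 3) (hcm : ¬ IsOfCMType (E.prod (E'.prod T)))
    (hna : ¬ ∃ E₀ T₀ : AbelianVariety ℂ, E₀.dim = 1 ∧ IsOfCMType E₀ ∧ T₀.IsSimple ∧ T₀.dim = 3 ∧
      AVDominatedBy E₀ (E.prod (E'.prod T)) ∧ AVDominatedBy T₀ (E.prod (E'.prod T)) ∧
      Nonempty (E₀.endAlgebra →+* T₀.endAlgebra))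
    (hEET : ∀ E₁ E₂ T₀ : AbelianVariety ℂ, E₁.dim = 1 → E₂.dim = 1 → IsOfCMType E₁ → IsOfCMType E₂ →
      ¬ AbelianVariety.IsIsogenous E₁ E₂ → T₀.dim = 3 → T₀.IsSimple → ¬ IsOfCMType T₀ → ¬ HasNoTypeIVFactor T₀ →
      IsEmpty (E₁.endAlgebra →+* T₀.endAlgebra) → IsEmpty (E₂.endAlgebra →+* T₀.endAlgebra) →
      AbelianVariety.IsIsogenous (E₁.prod (E₂.prod T₀)) (E.prod (E'.prod T)) →
      IsStablyNondegenerate (E₁.prod (E₂.prod T₀))) :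
    IsStablyNondegenerate (E.prod (E'.prod T)) := by
  have hEs : E.IsSimple := isSimple_of_dim_le_one hE.le
  have hE's : E'.IsSimple := isSimple_of_dim_le_one hE'.le
  by_cases hT : T.IsSimple
  swap
  · -- `T ∼ E'' × S`: four pieces
    obtain ⟨E'', S, hE'', hS2, hTiso⟩ := exists_curve_prod_surface_isIsogenous_of_not_isSimple_threefold hT3 hT
    have hrel : AbelianVariety.IsIsogenous (E.prod (E'.prod (E''.prod S))) (E.prod (E'.prod T)) :=
      (AbelianVariety.IsIsogenous.refl E).prod ((AbelianVariety.IsIsogenous.refl E').prod hTiso)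
    exact (isStablyNondegenerate_curve_prod_curve_prod_curve_prod_surface_of_not_isOfCMType hE hE' hE'' hS2
      (fun h => hcm ((isOfCMType_iff_of_isIsogenous hrel).1 h))).of_isIsogenous' hrel
  -- `T` simple; the dominations used for «not (e)/(f)»
  have hEX : AVDominatedBy E (E.prod (E'.prod T)) := SliceExhaustion.avDominatedBy_prod_left E _
  have hE'X : AVDominatedBy E' (E.prod (E'.prod T)) :=
    (SliceExhaustion.avDominatedBy_prod_left E' T).trans (avDominatedBy_prod_right E _)
  have hTX : AVDominatedBy T (E.prod (E'.prod T)) := (avDominatedBy_prod_right E' T).trans (avDominatedBy_prod_right E _)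
  have hET : IsStablyNondegenerate (E.prod T) :=
    isStablyNondegenerate_curve_prod_of_isSimple_threefold hE hT hT3
      (isEmpty_ringHom_of_not_exists_caseEF hE hT hT3 hEX hTX hna)
  have hE'T : IsStablyNondegenerate (E'.prod T) :=
    isStablyNondegenerate_curve_prod_of_isSimple_threefold hE' hT hT3
      (isEmpty_ringHom_of_not_exists_caseEF hE' hT hT3 hE'X hTX hna)
  by_cases hE'E : ∀ f : E' ⟶ E, f = 0
  swap
  · -- `E' ∼ E`: `X ∼ E² × T`
    push Not at hE'E
    obtain ⟨f, hf⟩ := hE'E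
    have hiso := isIsogenous_of_hom_ne_zero_of_curves hE' hE hf
    have hD : IsStablyNondegenerate ((E.powSucc 1).prod (T.powSucc 0)) := hET.powSucc_prod_powSucc 1 0
    change IsStablyNondegenerate ((E.prod E).prod T) at hD
    exact (hD.of_isIsogenous' (isIsogenous_prod_assoc E E T)).of_isIsogenous
      ((AbelianVariety.IsIsogenous.refl E).prod (hiso.prod (AbelianVariety.IsIsogenous.refl T)))
  have hTE : ∀ g : T ⟶ E, g = 0 := hom_eq_zero_of_isSimple_of_dim_ne hT hEs (by omega)
  by_cases hEcm : IsOfCMType E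
  swap
  · -- `E` non-CM, `Hom(E' × T, E) = 0`
    exact (hE'T.prod_nonCMCurve_of_forall_hom_eq_zero hE (finrank_endAlgebra_eq_one_of_curve_of_not_isOfCMType hE hEcm)
      (prod_hom_eq_zero_of_forall hE'E hTE)).of_isIsogenous' (isIsogenous_prod_comm _ E)
  by_cases hE'cm : IsOfCMType E'
  swap
  · -- `E` CM, `E'` non-CM: `Hom(E × T, E') = 0`, the row over `E × T`, then `(E × T) × E' ∼ E × (E' × T)`
    have hEE' : ∀ g : E ⟶ E', g = 0 := fun g => by
      by_contra hg
      exact hE'cm ((isOfCMType_iff_of_isIsogenous (isIsogenous_of_hom_ne_zero_of_curves hE hE' hg)).1 hEcm)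
    have hTE' : ∀ g : T ⟶ E', g = 0 := hom_eq_zero_of_isSimple_of_dim_ne hT hE's (by omega)
    exact ((hET.prod_nonCMCurve_of_forall_hom_eq_zero hE' (finrank_endAlgebra_eq_one_of_curve_of_not_isOfCMType hE' hE'cm)
      (prod_hom_eq_zero_of_forall hEE' hTE')).of_isIsogenous' (isIsogenous_prod_assoc E T E')).of_isIsogenous'
      ((AbelianVariety.IsIsogenous.refl E).prod (isIsogenous_prod_comm T E'))
  -- both curves of CM type, not isogenous
  have hniso : ¬ AbelianVariety.IsIsogenous E E' := by
    rintro ⟨g, hg⟩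
    obtain ⟨g', hg'⟩ := (AbelianVariety.IsIsogenous.symm' ⟨g, hg⟩ : AbelianVariety.IsIsogenous E' E)
    exact not_isIsogeny_zero_of_dim_pos (X := E') (Y := E) (by omega) (hE'E g' ▸ hg')
  by_cases hT4 : HasNoTypeIVFactor T
  · -- `T` without factor of Type IV: Thm. (3.2)(2) with `C = E × E'`
    have hTD : IsStablyNondegenerate T := isStablyNondegenerate_of_dim_pos_of_dim_le_three (by omega) hT3.le
    have hCD : IsStablyNondegenerate (E.prod E') :=
      isStablyNondegenerate_of_dim_pos_of_dim_le_three (by rw [dim_prod]; omega) (by rw [dim_prod]; omega)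
    exact ((hTD.prod_of_hasNoTypeIVFactor_of_isOfCMType hT4 (hEcm.prod hE'cm) hCD).of_isIsogenous'
      (isIsogenous_prod_comm T _)).of_isIsogenous' (isIsogenous_prod_assoc E E' T)
  by_cases hTcm : IsOfCMType T
  · exact absurd (hEcm.prod (hE'cm.prod hTcm)) hcm
  exact hEET E E' T hE hE' hEcm hE'cm hniso hT3 hT hTcm hT4
    (isEmpty_ringHom_of_not_exists_caseEF hE hT hT3 hEX hTX hna hEcm)
    (isEmpty_ringHom_of_not_exists_caseEF hE' hT hT3 hE'X hTX hna hE'cm) (AbelianVariety.IsIsogenous.refl _)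

/-- **`E × Z` for an elliptic curve `E` and a NON-SIMPLE abelian fourfold `Z`, the product NOT of CM type and outside
(e)/(f), is stably nondegenerate — GIVEN the row (5.11)** (`hEET`, relative to `E × Z`). `Z ∼ E' × T` or `Z ∼ S₁ × S₂`
(Poincaré, gen 58) and the previous theorems. [cite: MoonenZarhin1999LowDim, §5 (5.6)–(5.9), (5.11)] [cite: MumfordAV1970, §19 Thm. 1 (pp. 173–174)] -/
theorem isStablyNondegenerate_curve_prod_fourfold_of_not_isSimple_of_not_isOfCMType_of (hE : E.dim = 1)
    (hZ4 : Z.dim = 4) (hZ : ¬ Z.IsSimple) (hcm : ¬ IsOfCMType (E.prod Z))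
    (hna : ¬ ∃ E₀ T₀ : AbelianVariety ℂ, E₀.dim = 1 ∧ IsOfCMType E₀ ∧ T₀.IsSimple ∧ T₀.dim = 3 ∧
      AVDominatedBy E₀ (E.prod Z) ∧ AVDominatedBy T₀ (E.prod Z) ∧ Nonempty (E₀.endAlgebra →+* T₀.endAlgebra))
    (hEET : ∀ E₁ E₂ T₀ : AbelianVariety ℂ, E₁.dim = 1 → E₂.dim = 1 → IsOfCMType E₁ → IsOfCMType E₂ →
      ¬ AbelianVariety.IsIsogenous E₁ E₂ → T₀.dim = 3 → T₀.IsSimple → ¬ IsOfCMType T₀ → ¬ HasNoTypeIVFactor T₀ →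
      IsEmpty (E₁.endAlgebra →+* T₀.endAlgebra) → IsEmpty (E₂.endAlgebra →+* T₀.endAlgebra) →
      AbelianVariety.IsIsogenous (E₁.prod (E₂.prod T₀)) (E.prod Z) → IsStablyNondegenerate (E₁.prod (E₂.prod T₀))) :
    IsStablyNondegenerate (E.prod Z) := by
  obtain ⟨Y', Z', hdims, hiso⟩ := exists_prod_isIsogenous_of_not_isSimple_fourfold hZ4 hZ
  have hrel : AbelianVariety.IsIsogenous (E.prod (Y'.prod Z')) (E.prod Z) := (AbelianVariety.IsIsogenous.refl E).prod hiso
  obtain ⟨g, hg⟩ := hrel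
  have hcm' : ¬ IsOfCMType (E.prod (Y'.prod Z')) := fun h => hcm ((isOfCMType_iff_of_isIsogenous ⟨g, hg⟩).1 h)
  rcases hdims with ⟨hY1, hZ3⟩ | ⟨hY2, hZ2⟩
  · refine (isStablyNondegenerate_curve_prod_curve_prod_threefold_of_not_isOfCMType_of hE hY1 hZ3 hcm' ?_ ?_).of_isIsogenous' ⟨g, hg⟩
    · rintro ⟨E₀, T₀, h₀, hc₀, hTs, hT3, hE₀, hT₀, hne⟩
      exact hna ⟨E₀, T₀, h₀, hc₀, hTs, hT3, hE₀.trans_isIsogeny_hom hg, hT₀.trans_isIsogeny_hom hg, hne⟩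
    · intro E₁ E₂ T₀ h₁ h₂ c₁ c₂ hni hT3 hTs hTc hT4 i₁ i₂ hW
      exact hEET E₁ E₂ T₀ h₁ h₂ c₁ c₂ hni hT3 hTs hTc hT4 i₁ i₂ (hW.trans ⟨g, hg⟩)
  · exact (isStablyNondegenerate_curve_prod_surface_prod_surface_of_not_isOfCMType hE hY2 hZ2 hcm').of_isIsogenous' ⟨g, hg⟩

/-! ### §3 Moonen–Zarhin Thm. 0.2 (4) for non-simple fivefolds -/

/-- **MOONEN–ZARHIN Thm. 0.2 (4) FOR NON-SIMPLE FIVEFOLDS NOT OF CM TYPE, the rows (5.10)–(5.11) displayed.** Let `X` be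
a non-simple complex abelian fivefold, not of CM type, with no simple isogeny factor of dimension `4` (`h4`), outside the
cases (e)/(f) (`hna`: no elliptic curve `E` of CM type and simple threefold `T`, both isogeny factors of `X`, with
`End⁰(E) ↪ End⁰(T)`), and grant the two rows `hST`, `hEET` (relative to `X`). Then `B•(Xⁿ) = D•(Xⁿ)` for all `n`.
Proof: §1, then §2 on `X ∼ E × Z` / `X ∼ S × T` (a non-simple surface or threefold factor is split further, so that an
elliptic factor appears). [cite: MoonenZarhin1999LowDim, Thm. 0.2 (4) and §5 (5.6)–(5.11)] [cite: MumfordAV1970, §19 Thm. 1 (pp. 173–174)] -/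
theorem isStablyNondegenerate_of_dim_eq_five_of_not_isSimple_of_not_isOfCMType_of (hX5 : X.dim = 5)
    (hX : ¬ X.IsSimple) (hcm : ¬ IsOfCMType X)
    (h4 : ∀ F : AbelianVariety ℂ, F.IsSimple → F.dim = 4 → ¬ AVDominatedBy F X)
    (hna : ¬ ∃ E T : AbelianVariety ℂ, E.dim = 1 ∧ IsOfCMType E ∧ T.IsSimple ∧ T.dim = 3 ∧
      AVDominatedBy E X ∧ AVDominatedBy T X ∧ Nonempty (E.endAlgebra →+* T.endAlgebra))
    (hST : ∀ S T : AbelianVariety ℂ, S.dim = 2 → S.IsSimple → IsOfCMType S → T.dim = 3 → T.IsSimple →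
      ¬ IsOfCMType T → ¬ HasNoTypeIVFactor T → AbelianVariety.IsIsogenous (S.prod T) X → IsStablyNondegenerate (S.prod T))
    (hEET : ∀ E₁ E₂ T : AbelianVariety ℂ, E₁.dim = 1 → E₂.dim = 1 → IsOfCMType E₁ → IsOfCMType E₂ →
      ¬ AbelianVariety.IsIsogenous E₁ E₂ → T.dim = 3 → T.IsSimple → ¬ IsOfCMType T → ¬ HasNoTypeIVFactor T →
      IsEmpty (E₁.endAlgebra →+* T.endAlgebra) → IsEmpty (E₂.endAlgebra →+* T.endAlgebra) →
      AbelianVariety.IsIsogenous (E₁.prod (E₂.prod T)) X → IsStablyNondegenerate (E₁.prod (E₂.prod T))) :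
    IsStablyNondegenerate X := by
  -- the `E × Z` handler, for any isogeny `E × Z → X` with `Z` a non-simple fourfold
  have H : ∀ E Z : AbelianVariety ℂ, E.dim = 1 → Z.dim = 4 → ¬ Z.IsSimple →
      AbelianVariety.IsIsogenous (E.prod Z) X → IsStablyNondegenerate X := by
    intro E Z hE hZ4 hZ hrel
    obtain ⟨g, hg⟩ := hrel
    refine (isStablyNondegenerate_curve_prod_fourfold_of_not_isSimple_of_not_isOfCMType_of hE hZ4 hZ
      (fun h => hcm ((isOfCMType_iff_of_isIsogenous ⟨g, hg⟩).1 h))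
      (not_exists_caseEF_of_avDominatedBy ((AVDominatedBy.refl _).trans_isIsogeny_hom hg) hna) ?_).of_isIsogenous' ⟨g, hg⟩
    intro E₁ E₂ T₀ h₁ h₂ c₁ c₂ hni hT3 hTs hTc hT4 i₁ i₂ hW
    exact hEET E₁ E₂ T₀ h₁ h₂ c₁ c₂ hni hT3 hTs hTc hT4 i₁ i₂ (hW.trans ⟨g, hg⟩)
  obtain ⟨Y, Z, hdims, hiso⟩ := exists_prod_isIsogenous_of_not_isSimple_fivefold hX5 hX
  obtain ⟨g, hg⟩ := hiso
  rcases hdims with ⟨hY1, hZ4⟩ | ⟨hY2, hZ3⟩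
  · -- `X ∼ E × Z`
    by_cases hZ : Z.IsSimple
    · exact absurd ((avDominatedBy_prod_right Y Z).trans_isIsogeny_hom hg) (h4 Z hZ hZ4)
    · exact H Y Z hY1 hZ4 hZ ⟨g, hg⟩
  · -- `X ∼ S × T`
    by_cases hYs : Y.IsSimple
    swap
    · -- `S ∼ E₁ × E₂`: `X ∼ E₁ × (E₂ × T)`
      obtain ⟨E₁, E₂, h₁, h₂, hYiso⟩ := exists_curve_prod_curve_isIsogenous_of_not_isSimple_surface hY2 hYs
      exact H E₁ (E₂.prod Z) h₁ (by rw [dim_prod]; omega) (not_isSimple_prod_of_dim_pos (by omega) (by omega))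
        (((isIsogenous_prod_assoc E₁ E₂ Z).symm'.trans (hYiso.prod (AbelianVariety.IsIsogenous.refl Z))).trans ⟨g, hg⟩)
    by_cases hZs : Z.IsSimple
    swap
    · -- `T ∼ E × S'`: `X ∼ E × (S × S')`
      obtain ⟨E, S', hE, hS'2, hZiso⟩ := exists_curve_prod_surface_isIsogenous_of_not_isSimple_threefold hZ3 hZs
      exact H E (Y.prod S') hE (by rw [dim_prod]; omega) (not_isSimple_prod_of_dim_pos (by omega) (by omega))
        (((isIsogenous_prod_leftComm E Y S').trans ((AbelianVariety.IsIsogenous.refl Y).prod hZiso)).trans ⟨g, hg⟩)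
    -- both simple
    exact (isStablyNondegenerate_simpleSurface_prod_threefold_of_not_isOfCMType_of hY2 hYs hZ3
      (fun h => hcm ((isOfCMType_iff_of_isIsogenous ⟨g, hg⟩).1 h))
      (fun hTc hT4 hYc => hST Y Z hY2 hYs hYc hZ3 hZs hTc hT4 ⟨g, hg⟩)).of_isIsogenous' ⟨g, hg⟩

/-- **MOONEN–ZARHIN Thm. 0.2 (4) FOR NON-SIMPLE FIVEFOLDS, the rows (5.10)–(5.11) displayed.** Let `X` be a non-simple
complex abelian fivefold with no simple isogeny factor of dimension `4`, outside the cases (e)/(f), and grant the two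
displayed rows (relative to `X`; they only concern products NOT of CM type). Then `X` is stably nondegenerate:
`B•(Xⁿ) = D•(Xⁿ)` for all `n`. `X` of CM type: the CorCM classification of CM abelian varieties of dimension `≤ 5`
(cases (a⁺) — which for `T` of dimension `3` is (e)/(f), an elliptic isogeny factor of a CM variety being of CM type, and
for `T` of dimension `4` is excluded by `h4` — and (b′), vacuous under `h4`); `X` not of CM type: the previous theorem.
[cite: MoonenZarhin1999LowDim, Thm. 0.2 (4) and §5 (5.6)–(5.11)] [cite: Milne1999, §2 p. 54] -/
theorem isStablyNondegenerate_of_dim_eq_five_of_not_isSimple_of (hX5 : X.dim = 5) (hX : ¬ X.IsSimple)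
    (h4 : ∀ F : AbelianVariety ℂ, F.IsSimple → F.dim = 4 → ¬ AVDominatedBy F X)
    (hna : ¬ ∃ E T : AbelianVariety ℂ, E.dim = 1 ∧ IsOfCMType E ∧ T.IsSimple ∧ T.dim = 3 ∧
      AVDominatedBy E X ∧ AVDominatedBy T X ∧ Nonempty (E.endAlgebra →+* T.endAlgebra))
    (hST : ∀ S T : AbelianVariety ℂ, S.dim = 2 → S.IsSimple → IsOfCMType S → T.dim = 3 → T.IsSimple →
      ¬ IsOfCMType T → ¬ HasNoTypeIVFactor T → AbelianVariety.IsIsogenous (S.prod T) X → IsStablyNondegenerate (S.prod T))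
    (hEET : ∀ E₁ E₂ T : AbelianVariety ℂ, E₁.dim = 1 → E₂.dim = 1 → IsOfCMType E₁ → IsOfCMType E₂ →
      ¬ AbelianVariety.IsIsogenous E₁ E₂ → T.dim = 3 → T.IsSimple → ¬ IsOfCMType T → ¬ HasNoTypeIVFactor T →
      IsEmpty (E₁.endAlgebra →+* T.endAlgebra) → IsEmpty (E₂.endAlgebra →+* T.endAlgebra) →
      AbelianVariety.IsIsogenous (E₁.prod (E₂.prod T)) X → IsStablyNondegenerate (E₁.prod (E₂.prod T))) :
    IsStablyNondegenerate X := by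
  by_cases hcm : IsOfCMType X
  · have hna' : ¬ ∃ E T : AbelianVariety ℂ, E.dim = 1 ∧ T.IsSimple ∧ (T.dim = 3 ∨ T.dim = 4) ∧
        AVDominatedBy E X ∧ AVDominatedBy T X ∧ Nonempty (E.endAlgebra →+* T.endAlgebra) := by
      rintro ⟨E, T, hE, hTs, hT34, hEX, hTX, hne⟩
      rcases hT34 with hT3 | hT4
      · exact hna ⟨E, T, hE, isOfCMType_of_avDominatedBy hcm hEX, hTs, hT3, hEX, hTX, hne⟩
      · exact h4 T hTs hT4 hTX
    intro N
    exact isDivisorGenerated_of_avDominatedBy_powSucc_of_isOfCMType_of_dim_le_five hcm hX5.le hna'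
      (fun F hFs hF4 hFX => absurd hFX (h4 F hFs hF4)) (AVDominatedBy.refl _)
  · exact isStablyNondegenerate_of_dim_eq_five_of_not_isSimple_of_not_isOfCMType_of hX5 hX hcm h4 hna hST hEET

end Literature.AlgebraicGeometry.HodgeTheory.AbelianLowDimension.NonSimpleFivefolds

end

/-! ## Part 2: NonSimpleFivefoldsRowEET -/

noncomputable section

open _root_.CategoryTheory _root_.CategoryTheory.Limits

namespace Literature.AlgebraicGeometry.HodgeTheory.AbelianLowDimension.NonSimpleFivefolds

open Literature.AlgebraicGeometry.Motives (AbelianVariety)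
open Literature.AlgebraicGeometry.Motives.AbelianVariety
open Literature.AlgebraicGeometry.HodgeTheory
open Literature.AlgebraicGeometry.Milne1999
open Literature.AlgebraicGeometry.ComplexMultiplication
open Literature.AlgebraicGeometry.ComplexMultiplication.Domination

variable {X : AbelianVariety ℂ}

/-! ### §1 The row (5.11) as a theorem -/

/-- **The row (5.11), GLOBALLY: `E₁ × (E₂ × T)` is stably nondegenerate** for non-isogenous elliptic curves `E₁, E₂` of
CM type and a simple threefold `T` with a factor of Type IV, not of CM type, admitting neither `End⁰(E₁)` nor `End⁰(E₂)`
(the tree's `isStablyNondegenerate_cmCurve_prod_cmCurve_prod_threefold_of_typeIV_of_not_isOfCMType`: Prop. (3.8) for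
`Y = E₂ × T`, centre `k' × k''`). This is the hypothesis `hEET` of `isStablyNondegenerate_of_dim_eq_five_of_not_isSimple_of`.
[cite: MoonenZarhin1999LowDim, Thm. 0.2 (4), §3 Prop. (3.8) and §5 (5.11)] -/
theorem rowEET : ∀ E₁ E₂ T : AbelianVariety ℂ, E₁.dim = 1 → E₂.dim = 1 → IsOfCMType E₁ → IsOfCMType E₂ →
    ¬ AbelianVariety.IsIsogenous E₁ E₂ → T.dim = 3 → T.IsSimple → ¬ IsOfCMType T → ¬ HasNoTypeIVFactor T →
    IsEmpty (E₁.endAlgebra →+* T.endAlgebra) → IsEmpty (E₂.endAlgebra →+* T.endAlgebra) →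
    IsStablyNondegenerate (E₁.prod (E₂.prod T)) :=
  fun _ _ _ h₁ h₂ c₁ c₂ hni hT3 hTs hTc hT4 i₁ i₂ =>
    isStablyNondegenerate_cmCurve_prod_cmCurve_prod_threefold_of_typeIV_of_not_isOfCMType h₁ h₂ c₁ c₂ hni hT3 hTs hTc hT4
      i₁ i₂

/-- **Every non-simple complex abelian fivefold without simple fourfold factor, outside (e)/(f), is stably nondegenerate —
GIVEN ONLY the row (5.10)** (`hST`, relative to `X`: `S` a simple CM surface, `T` a simple threefold with a factor of Type
IV and not of CM type, `S × T ∼ X`). The row (5.11) of the master theorem is discharged by `rowEET`.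
[cite: MoonenZarhin1999LowDim, Thm. 0.2 (4) and §5 (5.6)–(5.11)] [cite: MumfordAV1970, §19 Thm. 1 (pp. 173–174)] -/
theorem isStablyNondegenerate_of_dim_eq_five_of_not_isSimple_of_rowST (hX5 : X.dim = 5) (hX : ¬ X.IsSimple)
    (h4 : ∀ F : AbelianVariety ℂ, F.IsSimple → F.dim = 4 → ¬ AVDominatedBy F X)
    (hna : ¬ ∃ E T : AbelianVariety ℂ, E.dim = 1 ∧ IsOfCMType E ∧ T.IsSimple ∧ T.dim = 3 ∧
      AVDominatedBy E X ∧ AVDominatedBy T X ∧ Nonempty (E.endAlgebra →+* T.endAlgebra))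
    (hST : ∀ S T : AbelianVariety ℂ, S.dim = 2 → S.IsSimple → IsOfCMType S → T.dim = 3 → T.IsSimple →
      ¬ IsOfCMType T → ¬ HasNoTypeIVFactor T → AbelianVariety.IsIsogenous (S.prod T) X → IsStablyNondegenerate (S.prod T)) :
    IsStablyNondegenerate X :=
  isStablyNondegenerate_of_dim_eq_five_of_not_isSimple_of hX5 hX h4 hna hST
    (fun E₁ E₂ T h₁ h₂ c₁ c₂ hni hT3 hTs hTc hT4 i₁ i₂ _ => rowEET E₁ E₂ T h₁ h₂ c₁ c₂ hni hT3 hTs hTc hT4 i₁ i₂)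

/-- **The master theorem with the single row (5.10) stated GLOBALLY** (the shape a future tree theorem «Lemma (3.6) for
the rank-two torus `U_F`» discharges). [cite: MoonenZarhin1999LowDim, Thm. 0.2 (4) and §5 (5.10)] -/
theorem isStablyNondegenerate_of_dim_eq_five_of_not_isSimple_of_rowST'
    (hST : ∀ S T : AbelianVariety ℂ, S.dim = 2 → S.IsSimple → IsOfCMType S → T.dim = 3 → T.IsSimple → ¬ IsOfCMType T →
      ¬ HasNoTypeIVFactor T → IsStablyNondegenerate (S.prod T))
    (hX5 : X.dim = 5) (hX : ¬ X.IsSimple) (h4 : ∀ F : AbelianVariety ℂ, F.IsSimple → F.dim = 4 → ¬ AVDominatedBy F X)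
    (hna : ¬ ∃ E T : AbelianVariety ℂ, E.dim = 1 ∧ IsOfCMType E ∧ T.IsSimple ∧ T.dim = 3 ∧
      AVDominatedBy E X ∧ AVDominatedBy T X ∧ Nonempty (E.endAlgebra →+* T.endAlgebra)) :
    IsStablyNondegenerate X :=
  isStablyNondegenerate_of_dim_eq_five_of_not_isSimple_of_rowST hX5 hX h4 hna
    (fun S T hS2 hSs hSc hT3 hTs hTc hT4 _ => hST S T hS2 hSs hSc hT3 hTs hTc hT4)

end Literature.AlgebraicGeometry.HodgeTheory.AbelianLowDimension.NonSimpleFivefolds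

end

/-! ## Part 3: NonSimpleFivefoldsComplete -/

noncomputable section

open _root_.CategoryTheory _root_.CategoryTheory.Limits

namespace Literature.AlgebraicGeometry.HodgeTheory.AbelianLowDimension.NonSimpleFivefolds

open Literature.AlgebraicGeometry.Motives (AbelianVariety)
open Literature.AlgebraicGeometry.Motives.AbelianVariety
open Literature.AlgebraicGeometry.HodgeTheory
open Literature.AlgebraicGeometry.Milne1999
open Literature.AlgebraicGeometry.ComplexMultiplication
open Literature.AlgebraicGeometry.ComplexMultiplication.Domination

variable {X : AbelianVariety ℂ}

/-! ### §1 The row (5.10) as a theorem -/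

/-- **The row (5.10) of Moonen–Zarhin Thm. 0.2 (4)** — a simple abelian surface of CM type times a simple abelian threefold
of Type IV not of CM type is stably nondegenerate — in the displayed shape of the prequels, BY NAME
(`isStablyNondegenerate_simpleCMSurface_prod_threefold_of_typeIV_of_not_isOfCMType`: Lemma (3.6) for `Hg(Y₁) = U_{F₁}`,
`F₁` without imaginary quadratic subfield). [cite: MoonenZarhin1999LowDim, §3 Lemma (3.6) and §5 (5.10)] -/
theorem rowST : ∀ S T : AbelianVariety ℂ, S.dim = 2 → S.IsSimple → IsOfCMType S → T.dim = 3 → T.IsSimple →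
    ¬ IsOfCMType T → ¬ HasNoTypeIVFactor T → IsStablyNondegenerate (S.prod T) :=
  fun _ _ hS2 hSs hSc hT3 hTs hTc hT4 =>
    isStablyNondegenerate_simpleCMSurface_prod_threefold_of_typeIV_of_not_isOfCMType hS2 hSs hSc hT3 hTs hTc hT4

/-! ### §2 Non-simple fivefolds: Thm. 0.2 (4), no displayed row -/

/-- **Moonen–Zarhin 1999 Thm. 0.2 (4) for non-simple fivefolds — every row a theorem.** Every NON-SIMPLE complex abelian
FIVEFOLD `X` without simple isogeny factor of dimension `4` and outside the printed cases (e)/(f) (no elliptic curve `E` of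
CM type and simple threefold `T` dominated by `X` with `End⁰(E) ↪ End⁰(T)`) is stably nondegenerate: `B•(Xⁿ) = D•(Xⁿ)`
for every `n` («if `X` has no simple factor of dimension 4 then `B•(Xⁿ) = D•(Xⁿ)` for every `n ≥ 1`», outside (e)/(f)).
[cite: MoonenZarhin1999LowDim, Thm. 0.2 (4) and §5 (5.6)–(5.11)] [cite: MumfordAV1970, §19 Thm. 1 (pp. 173–174)] -/
theorem isStablyNondegenerate_of_dim_eq_five_of_not_isSimple (hX5 : X.dim = 5) (hX : ¬ X.IsSimple)
    (h4 : ∀ F : AbelianVariety ℂ, F.IsSimple → F.dim = 4 → ¬ AVDominatedBy F X)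
    (hna : ¬ ∃ E T : AbelianVariety ℂ, E.dim = 1 ∧ IsOfCMType E ∧ T.IsSimple ∧ T.dim = 3 ∧
      AVDominatedBy E X ∧ AVDominatedBy T X ∧ Nonempty (E.endAlgebra →+* T.endAlgebra)) :
    IsStablyNondegenerate X :=
  isStablyNondegenerate_of_dim_eq_five_of_not_isSimple_of_rowST' rowST hX5 hX h4 hna

end Literature.AlgebraicGeometry.HodgeTheory.AbelianLowDimension.NonSimpleFivefolds

end

/-! ## Part 4: NonSimpleFivefoldsCodimTwo -/

noncomputable section

open _root_.CategoryTheory _root_.CategoryTheory.Limits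

namespace Literature.AlgebraicGeometry.HodgeTheory.AbelianLowDimension.NonSimpleFivefoldsCodimTwo

open Literature.AlgebraicGeometry.Motives (AbelianVariety)
open Literature.AlgebraicGeometry.Motives.AbelianVariety
open Literature.AlgebraicGeometry.HodgeTheory
open Literature.AlgebraicGeometry.Milne1999
open Literature.AlgebraicGeometry.ComplexMultiplication.Domination
open Literature.AlgebraicGeometry.HodgeTheory.AbelianLowDimension.NonSimpleFivefolds (isStablyNondegenerate_of_dim_eq_five_of_not_isSimple)
open Literature.AlgebraicGeometry.HodgeTheory.AbelianLowDimension.LowDimOfMarkman (exists_prod_isIsogenous_of_avDominatedBy exists_isIsogenous_curve_prod_of_avDominatedBy_of_dim_eq_five)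

variable {X F : AbelianVariety ℂ}

/-! ### §1 Fivefolds with a simple fourfold isogeny factor -/

/-- **A fivefold with a SIMPLE FOURFOLD isogeny factor `F` satisfies `B²(X) ⊆ D²(X) + Σ_α α^* B²(X')`, outside the
residual of case (g).** `X ∼ F × C` for an elliptic curve `C` (an isogeny factor has a complement); then the
Literature row `isCodimTwoDivisorPullbackGenerated_simpleFourfold_prod_curve` (Lemma (3.4) for `End⁰(C) = ℚ`,
Prop. (3.8) for balanced or absent central `k`, Thm. 0.2 (3) for `End⁰(F) = k`) and isogeny invariance. The hypothesis
`hres` excludes exactly: `C` of CM type (`χ ≫ χ = -d'`), `F` with a central `φ`, `φ ≫ φ = -(M²d')`, of unbalanced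
multiplicities, and `dim_ℚ End⁰(F) ≠ 2`. [cite: MoonenZarhin1999LowDim, Thm. 0.2 (3)–(4), §3 Lemma (3.4), Prop. (3.8)]
[cite: MumfordAV1970, §19 Thm. 1 (pp. 173–174)] -/
theorem isCodimTwoDivisorPullbackGenerated_of_avDominatedBy_simpleFourfold (hX5 : X.dim = 5) (hFs : F.IsSimple)
    (hF4 : F.dim = 4) (hFX : AVDominatedBy F X)
    (hres : ∀ C : AbelianVariety ℂ, C.dim = 1 → AbelianVariety.IsIsogenous X (F.prod C) →
      ∀ (χ : C ⟶ C) (d' : ℕ), 0 < d' → χ ≫ χ = -(d' • 𝟙 C) → ∀ (φ : F ⟶ F) (M : ℕ), 0 < M →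
      φ ≫ φ = -((M * M * d') • 𝟙 F) → AbelianVariety.endAlgebra.of F φ ∈ Subalgebra.center ℚ F.endAlgebra →
      eigenMultiplicity F φ (Complex.I * (Real.sqrt (M * M * d' : ℕ) : ℂ)) ≠
        eigenMultiplicity F φ (-(Complex.I * (Real.sqrt (M * M * d' : ℕ) : ℂ))) →
      Module.finrank ℚ F.endAlgebra = 2) :
    IsCodimTwoDivisorPullbackGenerated X := by
  obtain ⟨C, hdim, hFC⟩ := exists_prod_isIsogenous_of_avDominatedBy hFX
  have hC : C.dim = 1 := by omega
  exact (isCodimTwoDivisorPullbackGenerated_simpleFourfold_prod_curve hFs hF4 hC (hres C hC hFC.symm')).of_isIsogenous'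
    hFC

/-! ### §2 Every non-simple fivefold outside case (e) and the residual of case (g) -/

/-- **MOONEN–ZARHIN Thm. 0.2 IN CODIMENSION 2 FOR EVERY NON-SIMPLE COMPLEX ABELIAN FIVEFOLD OUTSIDE CASE (e) AND THE
RESIDUAL OF CASE (g) — UNCONDITIONAL: `B²(X) ⊆ D²(X) + Σ_α α^* B²(X')`.** With a simple fourfold isogeny factor: §1
(hypothesis `h4res`). Without: if no CM elliptic curve `E` and simple threefold `T` with `End⁰(E) ↪ End⁰(T)` are both
isogeny factors, Thm. 0.2 (4) (the cell's unconditional `isStablyNondegenerate_of_dim_eq_five_of_not_isSimple`,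
`B = D`); otherwise `X ∼ C × (E × T)` for an elliptic curve `C`: `C ≁ E` is case (f) (the Literature row
`isCodimTwoDivisorPullbackGenerated_of_isIsogenous_caseF`, «Case (f) is easy», (5.12)), `C ∼ E` is case (e), excluded by
`hne`. [cite: MoonenZarhin1999LowDim, Thm. 0.2 (2), (3), (4) with cases (e), (f), (g) and §5 (5.6)–(5.12)]
[cite: MumfordAV1970, §19 Thm. 1 and Cor. 1–2 (pp. 173–174)] -/
theorem isCodimTwoDivisorPullbackGenerated_of_dim_eq_five_of_not_isSimple (hX5 : X.dim = 5) (hX : ¬ X.IsSimple)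
    (h4res : ∀ F C : AbelianVariety ℂ, F.IsSimple → F.dim = 4 → C.dim = 1 →
      AbelianVariety.IsIsogenous X (F.prod C) →
      ∀ (χ : C ⟶ C) (d' : ℕ), 0 < d' → χ ≫ χ = -(d' • 𝟙 C) → ∀ (φ : F ⟶ F) (M : ℕ), 0 < M →
      φ ≫ φ = -((M * M * d') • 𝟙 F) → AbelianVariety.endAlgebra.of F φ ∈ Subalgebra.center ℚ F.endAlgebra →
      eigenMultiplicity F φ (Complex.I * (Real.sqrt (M * M * d' : ℕ) : ℂ)) ≠
        eigenMultiplicity F φ (-(Complex.I * (Real.sqrt (M * M * d' : ℕ) : ℂ))) →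
      Module.finrank ℚ F.endAlgebra = 2)
    (hne : ¬ ∃ E T : AbelianVariety ℂ, E.dim = 1 ∧ IsOfCMType E ∧ T.IsSimple ∧ T.dim = 3 ∧
      Nonempty (E.endAlgebra →+* T.endAlgebra) ∧ AbelianVariety.IsIsogenous X (E.prod (E.prod T))) :
    IsCodimTwoDivisorPullbackGenerated X := by
  by_cases h4 : ∃ F : AbelianVariety ℂ, F.IsSimple ∧ F.dim = 4 ∧ AVDominatedBy F X
  · obtain ⟨F, hFs, hF4, hFX⟩ := h4
    exact isCodimTwoDivisorPullbackGenerated_of_avDominatedBy_simpleFourfold hX5 hFs hF4 hFX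
      (fun C hC hXC => h4res F C hFs hF4 hC hXC)
  have h4' : ∀ F : AbelianVariety ℂ, F.IsSimple → F.dim = 4 → ¬ AVDominatedBy F X :=
    fun F hFs hF4 hFX => h4 ⟨F, hFs, hF4, hFX⟩
  by_cases hna : ∃ E T : AbelianVariety ℂ, E.dim = 1 ∧ IsOfCMType E ∧ T.IsSimple ∧ T.dim = 3 ∧
      AVDominatedBy E X ∧ AVDominatedBy T X ∧ Nonempty (E.endAlgebra →+* T.endAlgebra)
  · obtain ⟨E, T, hE, hEcm, hTs, hT3, hEX, hTX, ⟨j⟩⟩ := hna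
    obtain ⟨C, hC, hXC⟩ := exists_isIsogenous_curve_prod_of_avDominatedBy_of_dim_eq_five hX5 hE hTs hT3 hEX hTX
    by_cases hCE : AbelianVariety.IsIsogenous C E
    · -- case (e): excluded
      exact absurd ⟨E, T, hE, hEcm, hTs, hT3, ⟨j⟩, hXC.trans (hCE.prod (AbelianVariety.IsIsogenous.refl _))⟩ hne
    · -- case (f)
      exact isCodimTwoDivisorPullbackGenerated_of_isIsogenous_caseF hXC hC hE hEcm hCE hTs hT3 ⟨j⟩
  · exact (isStablyNondegenerate_of_dim_eq_five_of_not_isSimple hX5 hX h4' hna).isCodimTwoDivisorPullbackGenerated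

end Literature.AlgebraicGeometry.HodgeTheory.AbelianLowDimension.NonSimpleFivefoldsCodimTwo

end
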